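import Summits.Ventures.HSemireg.Mod4BlockAssembly
import Summits.Ventures.HSemireg.Mod4SiteSigns
import Summits.Ventures.HSemireg.Mod4MiddleMatrixSquareRoot

/-!
# Venture HSemireg — MOD-4 line: the coupled block `U` of THEOREM R_f's middle degree has dimension
# `2^{n+1} − dim ker(M_f − αβ)` (every `n`, every coefficient sequence, any field, any independent tag family)

HONEST FRAMING. Part of the Lean index of the computation cell `pub-hsemireg` (widening group W3, seat w3-mod4-1 gen 5; files
of record `HOME/widen/W3/MOD4-OFFSPLIT-w3mod4.md` §10.2 / §11, `MOD4-THEOREM-RF-PROOF-w3mod4.md` v1.0 §4).  LINEAR ALGEBRA OVER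
A FIELD ONLY: no abelian variety, no sheaf, no Ext group, no semiregularity map; nothing here says that HC, HC_CM or HC_AV holds;
no Literature fact is declared (the tree's PROVED Guttman rank additivity enters through `Mod4BlockAssembly.lean`).  THEOREM R_f
is NOT asserted here.  WHAT IS PROVED: the proof sheet §4 shows that the `2ⁿ + 2ⁿ` degree-`n` words living on one half of the
sites give, in the tag basis `(g_B)_B ⊔ (f_{B′})_{B′}` of `U`, the vectors `r_B = α·g_B + Σ_{B′} Σ₁[B,B′]·f_{B′}` and
`s_{B′} = Σ_B Σ₂[B′,B]·g_B + β·f_{B′}` with `Σ₁[B,B′] = κ(−1)^{|B′|}q_{n−|B|+|B′|}`, `Σ₂[B′,B] = (−1)ⁿκ(−1)^{|B|}q_{n−|B′|+|B|}`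
(`κ = (−1)^{C(n+1,2)}`; the `Σ₁` row is kernel-checked in `Mod4SiteSigmaRows.lean`).  HERE: for ANY linearly independent family
`g ⊔ f` indexed by the subsets of `[n]` twice, in any vector space over any field `K`, any `q : ℕ → K` and `α, β ≠ 0`,
**`dim span{r_B, s_{B′}} + dim ker(M_f − αβ) = 2ⁿ + 2ⁿ`** (`finrank_span_Ublock`), where `M_f = Mod4.middleM n q` is seat g4's
middle-degree matrix (`(M_f)_{ab} = (−1)^{n+b}C(n,b)Σ_m(−1)^mC(n,m)q_{n−a+m}q_{n−m+b}`, `Mod4MiddleMatrixSquareRoot.lean`).  Route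
(all kernel): dim span of a family with coefficient matrix `C` over an independent family = `rank C` (`finrank_span_combination`);
`C = [[α·1, Σ₁],[Σ₂, β·1]]` ⇒ `rank C = 2ⁿ + rank(αβ·1 − Σ₂Σ₁)` (`Mod4Site.rank_fromBlocks_scalar`); `Σ₂Σ₁ = Z·K·Zᵀ` with
`Z_{B,a} = [|B| = a]` (`sigmaTwo_mul_sigmaOne`, grouping the `B`-sum by `|B|`); rank–nullity; `dim ker(Z·K·Zᵀ − c) = dim ker(K·ZᵀZ − c)`
(`Mod4Site.finrank_ker_ZKZt`) and `K·ZᵀZ = M_f` (`kMat_mul_transpose_sizeIndicator_mul`).  What THEOREM R_f's middle-degree proof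
needs beyond this file and its predecessors is only the support bookkeeping (the four families have pairwise disjoint monomial
supports; the tags are distinct monomials) — recorded as pencil in MOD4-OFFSPLIT §11.5.
All statements and proofs: w3-mod4-1 g5 (2026-08-23).  Namespace `Summit.Ventures.HSemireg.Mod4Site`.
-/

namespace Summit.Ventures.HSemireg.Mod4Site

open Matrix Summit.Ventures.HSemireg.Mod4

variable {K : Type*} [Field K]

/-! ### §1 The dimension of the span of a family given by a coefficient matrix over an independent family -/

section SpanRank

variable {V : Type*} [AddCommGroup V] [Module K V] {ι ρ : Type*} [Fintype ι] [Fintype ρ]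

/-- if `e` is linearly independent, the span of the vectors `Σ_j C_{ij}·e_j` (`i ∈ ρ`) has dimension `rank C`. -/
theorem finrank_span_combination (e : ι → V) (he : LinearIndependent K e) (C : Matrix ρ ι K) :
    Module.finrank K (Submodule.span K (Set.range fun i => ∑ j, C i j • e j)) = C.rank := by
  classical
  have h1 : (fun i => ∑ j, C i j • e j) = Fintype.linearCombination K e ∘ C.row := by
    funext i
    rw [Function.comp_apply, Fintype.linearCombination_apply]
    rfl
  rw [h1, Set.range_comp, Submodule.span_image, Matrix.rank_eq_finrank_span_row]
  exact LinearEquiv.finrank_eq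
    (Submodule.equivMapOfInjective _ (he.fintypeLinearCombination_injective) _).symm

end SpanRank

/-! ### §2 The matrices `Σ₁`, `Σ₂`, the size indicator `Z`, the size kernel `K` and their identities -/

section Matrices

variable {n : ℕ}

/-- grouping a sum over all subsets of `[n]` by cardinality: `Σ_B G(|B|) = Σ_{m ≤ n} C(n,m)·G(m)`. -/
lemma sum_univ_finset_card (G : ℕ → K) :
    ∑ B : Finset (Fin n), G B.card = ∑ m ∈ Finset.range (n + 1), (n.choose m : K) * G m := by
  rw [← Finset.powerset_univ, Finset.sum_powerset_apply_card]
  simp only [Finset.card_univ, Fintype.card_fin, nsmul_eq_mul]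

/-- `κ² = 1` for `κ = (−1)^{C(n+1,2)}`. -/
lemma kappa_mul_kappa : ((-1 : K) ^ (n + 1).choose 2) * ((-1 : K) ^ (n + 1).choose 2) = 1 := by
  rw [← pow_add, ← two_mul, pow_mul, neg_one_sq, one_pow]

/-- **`Σ₂·Σ₁ = Z·K·Zᵀ`** (proof sheet §4 «size reduction»): with `Σ₁[B,B′] = κ(−1)^{|B′|}q_{n−|B|+|B′|}`,
`Σ₂[B′,B] = (−1)ⁿκ(−1)^{|B|}q_{n−|B′|+|B|}`, `Z_{B,a} = [|B| = a]` and
`K_{ab} = (−1)^{n+b}Σ_m(−1)^mC(n,m)q_{n−a+m}q_{n−m+b}`: `(Σ₂Σ₁)[B′₁,B′₂] = K_{|B′₁|,|B′₂|}` — the `B`-sum sees only `|B|`. -/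
theorem sigmaTwo_mul_sigmaOne (q : ℕ → K) :
    (Matrix.of fun (B' B : Finset (Fin n)) =>
        (-1 : K) ^ n * (-1 : K) ^ (n + 1).choose 2 * (-1 : K) ^ B.card * q (n - B'.card + B.card)) *
      (Matrix.of fun (B B' : Finset (Fin n)) =>
        (-1 : K) ^ (n + 1).choose 2 * (-1 : K) ^ B'.card * q (n - B.card + B'.card)) =
    (Matrix.of fun (B : Finset (Fin n)) (a : Fin (n + 1)) => if B.card = (a : ℕ) then (1 : K) else 0) *
      (Matrix.of fun (a b : Fin (n + 1)) => (-1 : K) ^ (n + (b : ℕ)) *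
        ∑ m : Fin (n + 1), (-1 : K) ^ (m : ℕ) * (n.choose (m : ℕ) : K) * q (n - (a : ℕ) + (m : ℕ)) * q (n - (m : ℕ) + (b : ℕ))) *
      (Matrix.of fun (B : Finset (Fin n)) (a : Fin (n + 1)) => if B.card = (a : ℕ) then (1 : K) else 0).transpose := by
  ext B₁ B₂
  have h1 : B₁.card < n + 1 := Nat.lt_succ_of_le (by simpa using Finset.card_le_univ B₁)
  have h2 : B₂.card < n + 1 := Nat.lt_succ_of_le (by simpa using Finset.card_le_univ B₂)
  -- right-hand side: the indicator rows pick the entry `K_{|B₁|,|B₂|}`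
  have rhs : ((Matrix.of fun (B : Finset (Fin n)) (a : Fin (n + 1)) => if B.card = (a : ℕ) then (1 : K) else 0) *
      (Matrix.of fun (a b : Fin (n + 1)) => (-1 : K) ^ (n + (b : ℕ)) *
        ∑ m : Fin (n + 1), (-1 : K) ^ (m : ℕ) * (n.choose (m : ℕ) : K) * q (n - (a : ℕ) + (m : ℕ)) * q (n - (m : ℕ) + (b : ℕ))) *
      (Matrix.of fun (B : Finset (Fin n)) (a : Fin (n + 1)) => if B.card = (a : ℕ) then (1 : K) else 0).transpose) B₁ B₂ =
      (-1 : K) ^ (n + B₂.card) *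
        ∑ m : Fin (n + 1), (-1 : K) ^ (m : ℕ) * (n.choose (m : ℕ) : K) * q (n - B₁.card + (m : ℕ)) * q (n - (m : ℕ) + B₂.card) := by
    rw [Matrix.mul_apply, Finset.sum_eq_single ⟨B₂.card, h2⟩]
    · rw [Matrix.transpose_apply, Matrix.of_apply, if_pos rfl, mul_one, Matrix.mul_apply, Finset.sum_eq_single ⟨B₁.card, h1⟩]
      · rw [Matrix.of_apply, if_pos rfl, one_mul, Matrix.of_apply]
      · intro a _ ha
        rw [Matrix.of_apply, if_neg (fun h => ha (Fin.ext h.symm)), zero_mul]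
      · intro h; exact (h (Finset.mem_univ _)).elim
    · intro b _ hb
      rw [Matrix.transpose_apply, Matrix.of_apply, if_neg (fun h => hb (Fin.ext h.symm)), mul_zero]
    · intro h; exact (h (Finset.mem_univ _)).elim
  rw [rhs, Matrix.mul_apply]
  simp only [Matrix.of_apply]
  -- left-hand side: group the `B`-sum by `|B|`
  set G : ℕ → K := fun m => (-1 : K) ^ (n + B₂.card) * ((-1 : K) ^ m * q (n - B₁.card + m) * q (n - m + B₂.card))
    with hG
  have lhs : ∑ B : Finset (Fin n),
      (-1 : K) ^ n * (-1 : K) ^ (n + 1).choose 2 * (-1 : K) ^ B.card * q (n - B₁.card + B.card) *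
        ((-1 : K) ^ (n + 1).choose 2 * (-1 : K) ^ B₂.card * q (n - B.card + B₂.card)) =
      ∑ B : Finset (Fin n), G B.card := by
    refine Finset.sum_congr rfl fun B _ => ?_
    have hk := kappa_mul_kappa (K := K) (n := n)
    rw [hG, pow_add]
    linear_combination ((-1 : K) ^ n * (-1 : K) ^ B.card * (-1 : K) ^ B₂.card * q (n - B₁.card + B.card) *
      q (n - B.card + B₂.card)) * hk
  rw [lhs, sum_univ_finset_card G, Finset.mul_sum,
    ← Fin.sum_univ_eq_sum_range (f := fun m => (n.choose m : K) * G m) (n := n + 1)]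
  refine Finset.sum_congr rfl fun m _ => ?_
  rw [hG]
  ring

/-- **`K·(ZᵀZ) = M_f`**: `(ZᵀZ)_{ab} = [a = b]·C(n,a)` (`transpose_sizeIndicator_mul`), so `K·D` is seat g4's `middleM n q`. -/
theorem kMat_mul_transpose_sizeIndicator_mul (q : ℕ → K) :
    (Matrix.of fun (a b : Fin (n + 1)) => (-1 : K) ^ (n + (b : ℕ)) *
        ∑ m : Fin (n + 1), (-1 : K) ^ (m : ℕ) * (n.choose (m : ℕ) : K) * q (n - (a : ℕ) + (m : ℕ)) * q (n - (m : ℕ) + (b : ℕ))) *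
      ((Matrix.of fun (B : Finset (Fin n)) (a : Fin (n + 1)) => if B.card = (a : ℕ) then (1 : K) else 0).transpose *
        (Matrix.of fun (B : Finset (Fin n)) (a : Fin (n + 1)) => if B.card = (a : ℕ) then (1 : K) else 0)) =
      middleM n q := by
  ext a b
  rw [Matrix.mul_apply, Finset.sum_eq_single b]
  · rw [transpose_sizeIndicator_mul, if_pos rfl, Matrix.of_apply, middleM]
    ring
  · intro c _ hc
    rw [transpose_sizeIndicator_mul, if_neg hc, mul_zero]
  · intro h; exact (h (Finset.mem_univ _)).elim

end Matrices

/-! ### §3 The `U`-block -/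

section UBlock

variable {V : Type*} [AddCommGroup V] [Module K V] {n : ℕ}

/-- kernel bookkeeping: `ker((c·1 − N)·) = ker(N· − c)` (as `mulVecLin` vs `toLin'`). -/
lemma finrank_ker_smul_one_sub (N : Matrix (Finset (Fin n)) (Finset (Fin n)) K) (c : K) :
    Module.finrank K (LinearMap.ker ((c • (1 : Matrix (Finset (Fin n)) (Finset (Fin n)) K) - N).mulVecLin)) =
      Module.finrank K (LinearMap.ker (Matrix.toLin' N - c • LinearMap.id)) := by
  have h : (c • (1 : Matrix (Finset (Fin n)) (Finset (Fin n)) K) - N).mulVecLin = -(Matrix.toLin' N - c • LinearMap.id) := by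
    apply LinearMap.ext
    intro v
    simp only [Matrix.mulVecLin_apply, Matrix.sub_mulVec, Matrix.smul_mulVec, Matrix.one_mulVec,
      LinearMap.sub_apply, Matrix.toLin'_apply, LinearMap.smul_apply, LinearMap.id_apply, neg_sub]
  rw [h, LinearMap.ker_neg]

/-- **THE `U`-BLOCK OF THEOREM R_f's MIDDLE DEGREE.** For any linearly independent family `g ⊔ f` indexed twice by the
subsets of `[n]` (the tags `g_B = μ_B·m_Q`, `f_{B′} = m_P·μ′_{B′}`), any `q : ℕ → K` and `α, β ≠ 0`, the `2ⁿ + 2ⁿ` vectors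
`r_B = α·g_B + Σ_{B′} κ(−1)^{|B′|}q_{n−|B|+|B′|}·f_{B′}` and `s_{B′} = Σ_B (−1)ⁿκ(−1)^{|B|}q_{n−|B′|+|B|}·g_B + β·f_{B′}`
(`κ = (−1)^{C(n+1,2)}`) span a space of dimension `2^{n+1} − dim ker(M_f − αβ)`, `M_f = Mod4.middleM n q`. -/
theorem finrank_span_Ublock (g f : Finset (Fin n) → V) (hind : LinearIndependent K (Sum.elim g f))
    (q : ℕ → K) {α β : K} (hα : α ≠ 0) (hβ : β ≠ 0) :
    Module.finrank K (Submodule.span K (Set.range (Sum.elim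
        (fun B : Finset (Fin n) => α • g B + ∑ B' : Finset (Fin n),
          ((-1 : K) ^ (n + 1).choose 2 * (-1 : K) ^ B'.card * q (n - B.card + B'.card)) • f B')
        (fun B' : Finset (Fin n) => (∑ B : Finset (Fin n),
          ((-1 : K) ^ n * (-1 : K) ^ (n + 1).choose 2 * (-1 : K) ^ B.card * q (n - B'.card + B.card)) • g B) +
            β • f B')))) +
      Module.finrank K (LinearMap.ker (Matrix.toLin' (middleM n q) - (α * β) • LinearMap.id)) = 2 ^ n + 2 ^ n := by
  classical
  set S1 : Matrix (Finset (Fin n)) (Finset (Fin n)) K :=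
    Matrix.of fun (B B' : Finset (Fin n)) => (-1 : K) ^ (n + 1).choose 2 * (-1 : K) ^ B'.card * q (n - B.card + B'.card)
    with hS1
  set S2 : Matrix (Finset (Fin n)) (Finset (Fin n)) K :=
    Matrix.of fun (B' B : Finset (Fin n)) =>
      (-1 : K) ^ n * (-1 : K) ^ (n + 1).choose 2 * (-1 : K) ^ B.card * q (n - B'.card + B.card) with hS2
  set C : Matrix (Finset (Fin n) ⊕ Finset (Fin n)) (Finset (Fin n) ⊕ Finset (Fin n)) K :=
    Matrix.fromBlocks (α • (1 : Matrix (Finset (Fin n)) (Finset (Fin n)) K)) S1 S2 (β • 1) with hC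
  -- the family is the `C`-combination of the independent family `e := g ⊔ f`
  have hfam : Sum.elim
        (fun B : Finset (Fin n) => α • g B + ∑ B' : Finset (Fin n),
          ((-1 : K) ^ (n + 1).choose 2 * (-1 : K) ^ B'.card * q (n - B.card + B'.card)) • f B')
        (fun B' : Finset (Fin n) => (∑ B : Finset (Fin n),
          ((-1 : K) ^ n * (-1 : K) ^ (n + 1).choose 2 * (-1 : K) ^ B.card * q (n - B'.card + B.card)) • g B) +
            β • f B') =
      fun i => ∑ j, C i j • Sum.elim g f j := by
    funext i
    cases i with
    | inl B =>
      rw [Sum.elim_inl, Fintype.sum_sum_type]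
      simp only [hC, Matrix.fromBlocks_apply₁₁, Matrix.fromBlocks_apply₁₂, Sum.elim_inl, Sum.elim_inr, Matrix.smul_apply,
        Matrix.one_apply, smul_eq_mul, mul_ite, mul_one, mul_zero, ite_smul, zero_smul, Finset.sum_ite_eq,
        Finset.mem_univ, if_true, hS1, Matrix.of_apply]
    | inr B' =>
      rw [Sum.elim_inr, Fintype.sum_sum_type]
      simp only [hC, Matrix.fromBlocks_apply₂₁, Matrix.fromBlocks_apply₂₂, Sum.elim_inl, Sum.elim_inr, Matrix.smul_apply,
        Matrix.one_apply, smul_eq_mul, mul_ite, mul_one, mul_zero, ite_smul, zero_smul, Finset.sum_ite_eq,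
        Finset.mem_univ, if_true, hS2, Matrix.of_apply]
  rw [hfam, finrank_span_combination _ hind C, hC, rank_fromBlocks_scalar hα β S1 S2]
  have hcard : Fintype.card (Finset (Fin n)) = 2 ^ n := by rw [Fintype.card_finset, Fintype.card_fin]
  have hrn := card_eq_rank_add_finrank_ker ((α * β) • (1 : Matrix (Finset (Fin n)) (Finset (Fin n)) K) - S2 * S1)
  rw [hcard] at hrn
  have hker : Module.finrank K (LinearMap.ker
      (((α * β) • (1 : Matrix (Finset (Fin n)) (Finset (Fin n)) K) - S2 * S1).mulVecLin)) =
      Module.finrank K (LinearMap.ker (Matrix.toLin' (middleM n q) - (α * β) • LinearMap.id)) := by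
    rw [finrank_ker_smul_one_sub, hS2, hS1, sigmaTwo_mul_sigmaOne q, finrank_ker_ZKZt _ _ (mul_ne_zero hα hβ),
      kMat_mul_transpose_sizeIndicator_mul]
  omega

end UBlock

end Summit.Ventures.HSemireg.Mod4Site
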